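import Summits.QuantumFields.YangMills.Theorems.UnitScaleTiltProp7CovAgmonInterp
import HarnessLib

/-!
# Route `UnitScaleTilt`, crux K1 «MinimiserStabilityRegPr» (stmt-QuantumFields-19200), route-R E′ path (α′), S2 ∕ (E1-b) at the CURVED background — (D2′-cov) FILE 3a:
# THE PIECES OF THE COVARIANT AGMON ESTIMATE — the four pairings of the Euler–Lagrange test `v = ω²•e` (Laplacian side from below, type-1, bond and site sources) and the
# two commutators (`θ = 1` and `θ = ω⁻¹`), each as a stand-alone inequality in HS-weighted letters (assembled in FILE 3b `…CovAgmonDecay`)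

Cell `ym3-torus`, extra width seat `ym-routeR-w6` (gen 6); LOCATE `ym-routeR-w6/LOCATE-PCOV2-routeRw6g6.md` v1.1 (§1 (D2′-cov); §4: energy bricks are holonomy-blind).  THEOREMS ONLY
(0 `def`, 0 `sorry`); `--supports stmt-QuantumFields-19200`, count-neutral.  YM₃ on T³ is a ladder rung (R3), not the Clay problem; nothing here claims a stub, the crux, d = 4 or
the mass gap.

THE POINT.  The covariant (hK) rows of P-cov1 ✓p655977 are, by ✓ `Prop7CovInterpKernelDual`, `ℓ¹`-of-HS bounds `Σ_z‖Δ_Uw(z)‖_HS` for explicit pinned fields `w` solving a pinned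
least-squares problem with localized sources — exactly the situation of the flat (A-door) ✓p663210, whose decay input is the flat Agmon estimate ✓p660232.  This file is that
estimate at a unitary background `U`: DATA a scalar weight `ω > 0` with difference constants `a ≤ 1∕2`, `b`; the pinned covariant Poincaré row `√Σhs(v) ≤ A·√Σhs(Δ_Uv)`
((D1-cov) ✓p668134 in root form: `A = √C′_G·ℓ²`); a pinned `e` solving the EULER–LAGRANGE identity with three covariant source types
`Σ⟨Δ_Ue, Δ_Uv⟩ = Σ⟨h, Δ_Uv⟩ + Σ_{x,μ}⟨ht_μ, D_μv⟩ + Σ⟨s, v⟩` (pairing `Re Tr(X^*Y)`) for all pinned `v`; THEN with `E N G H Ht S` the `ω`-weighted HS-`ℓ²` sizes of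
`Δ_Ue, e, D_Ue, h, ht, s`: `E ≤ 3H + 2(g₁ + γA′)Ht + 2A′S`, `N ≤ A′E`, `G ≤ g₁E` under the flat file's two scale-free windows `H1`, `H2` (same `p γ A′ g₁ τ` at `c = 1`).  PROOF =
the flat proof line by line with `|·| ↦ √hs`, products ↦ pairings: FILE 2's weighted interpolation (STEP I), FILE 1's commutator bound at `θ = 1` + Minkowski + the Poincaré row
(STEP P), the EL identity tested with `v = ω²•e`, FILE 1's commutator bound at `θ = ω⁻¹` with ✓ `sq_weight_rows`, two-sided Cauchy–Schwarz, FILE 2's transport remainder.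

HONEST SCOPE.  (D1-cov) is DISPLAYED (its member-level frames are displayed in ✓p668134); the weight is DISPLAYED (consumer: ✓p660013's `exp(κρ∕ℓ)`); constants crude; the
covariant (EL-loc)∕(A-door)∕near-field transplant are NOT here.

References: T. Bałaban, CMP 96 (1984) 223–250 [Balaban1984PropagatorsII] ((1.9) p.226); CMP 99 (1985) 389–434 [Balaban1985BackgroundPropagators] ((3.8) p.392); CMP 99 (1985) 75–102
[Balaban1985RegularSpaces] ((1.14) p.78, (1.36) p.82); S. Agmon, Princeton Math. Notes 29 (1982) (method).
-/

set_option autoImplicit false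

noncomputable section

open scoped BigOperators Matrix.Norms.L2Operator Matrix

namespace Summit.QuantumFields.YangMills.Theorems.Prop7CovAgmonPieces

open Literature.MathematicalPhysics.QuantumFieldTheory.Balaban1983to89
open B10StarCount (shift_unshift unshift_shift)
open B9Eq39Adjoint (R covD covDstar divB)
open B9TorusCalculus (torusT torusT_apply torusT_symm_apply)
open Summit.QuantumFields.YangMills.Theorems.Prop7CovariantCoercivity (re_trace_conjTranspose_mul_self)
open Summit.QuantumFields.YangMills.Theorems.Prop7PinnedBiharmonicAgmonInterp (sq_weight_rows sqrt_comm_bound_le)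
open Summit.QuantumFields.YangMills.Theorems.Prop7CovAgmonLetters (hs_smul covD_smul_fun_src sum_hs_weighted_comm_le)
open Summit.QuantumFields.YangMills.Theorems.Prop7CovAgmonInterp (sum_re_trace_le_sqrt_mul_sqrt abs_sum_re_trace_le_sqrt_mul_sqrt re_trace_conjTranspose_mul_smul
  re_trace_smul_smul sqrt_sum_hs_add_le weighted_covGrad_sq_le sum_hs_sqweight_transport_le)

variable {P : Params} {i : ℕ} {N : ℕ}

/-! ## §1 The four pairings of the Euler–Lagrange test `v = ω²•e`, and the two commutators -/

section Pieces

variable {U : Fin P.d → Site P i → (Matrix (Fin N) (Fin N) ℂ)ˣ}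

omit U in
/-- `ω²·hs X = hs(ω•X)`. [folklore] -/
theorem wt_hs (r : ℝ) (X : Matrix (Fin N) (Fin N) ℂ) :
    r ^ 2 * ∑ j : Fin N, ∑ k : Fin N, ‖X j k‖ ^ 2 = ∑ j : Fin N, ∑ k : Fin N, ‖(r • X) j k‖ ^ 2 := (hs_smul r X).symm

omit U in
/-- the splitting of a pairing against `ω²•Y + R₂`: `⟨X, ω²•Y + R₂⟩ = ⟨ω•X, ω•Y⟩ + ⟨ω•X, ω⁻¹•R₂⟩` (`ω ≠ 0`). [folklore] -/
theorem re_trace_split {ωx : ℝ} (hω : ωx ≠ 0) (X Y R₂ : Matrix (Fin N) (Fin N) ℂ) :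
    ((Xᴴ * ((ωx ^ 2) • Y + R₂)).trace).re
      = (((ωx • X)ᴴ * (ωx • Y)).trace).re + (((ωx • X)ᴴ * (ωx⁻¹ • R₂)).trace).re := by
  have hx1 : ωx * ωx⁻¹ = 1 := mul_inv_cancel₀ hω
  rw [mul_add, Matrix.trace_add, Complex.add_re, re_trace_conjTranspose_mul_smul, re_trace_smul_smul, re_trace_smul_smul, hx1, one_mul, sq]

/-- ★ **THE LAPLACIAN SIDE FROM BELOW**: with `R₂ := Δ_U(ω²•e) − ω²•Δ_Ue`, `E := √Σω²hs(Δ_Ue)`, `R := √Σhs(ω⁻¹•R₂)`: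
`E² − E·R ≤ Σ_x⟨Δ_Ue, Δ_U(ω²•e)⟩`. [cite: Balaban1984PropagatorsII, (1.9) p.226] -/
theorem el_lhs_ge (ω : Site P i → ℝ) (hω₀ : ∀ x, 0 < ω x) (e : Site P i → Matrix (Fin N) (Fin N) ℂ) :
    Real.sqrt (∑ x, ω x ^ 2 * ∑ j : Fin N, ∑ k : Fin N, ‖(divB (torusT P i) U (fun μ => covD (torusT P i) U μ e) x) j k‖ ^ 2) ^ 2
      - Real.sqrt (∑ x, ω x ^ 2 * ∑ j : Fin N, ∑ k : Fin N, ‖(divB (torusT P i) U (fun μ => covD (torusT P i) U μ e) x) j k‖ ^ 2)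
        * Real.sqrt (∑ x, ∑ j : Fin N, ∑ k : Fin N, ‖((ω x)⁻¹ • (divB (torusT P i) U (fun μ => covD (torusT P i) U μ (fun z => (ω z ^ 2) • e z)) x
            - (ω x ^ 2) • divB (torusT P i) U (fun μ => covD (torusT P i) U μ e) x)) j k‖ ^ 2)
      ≤ ∑ x, (((divB (torusT P i) U (fun μ => covD (torusT P i) U μ e) x)ᴴ
          * divB (torusT P i) U (fun μ => covD (torusT P i) U μ (fun z => (ω z ^ 2) • e z)) x).trace).re := by
  set Le : Site P i → Matrix (Fin N) (Fin N) ℂ := fun x => divB (torusT P i) U (fun μ => covD (torusT P i) U μ e) x with hLe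
  set R₂ : Site P i → Matrix (Fin N) (Fin N) ℂ := fun x => divB (torusT P i) U (fun μ => covD (torusT P i) U μ (fun z => (ω z ^ 2) • e z)) x - (ω x ^ 2) • Le x
    with hR₂
  have hE2pos : 0 ≤ ∑ x, ω x ^ 2 * ∑ j : Fin N, ∑ k : Fin N, ‖(Le x) j k‖ ^ 2 := Finset.sum_nonneg fun _ _ => by positivity
  have e0 : ∀ x, divB (torusT P i) U (fun μ => covD (torusT P i) U μ (fun z => (ω z ^ 2) • e z)) x = (ω x ^ 2) • Le x + R₂ x := fun x => by
    simp only [hR₂]; abel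
  have e1 : ∑ x, (((Le x)ᴴ * divB (torusT P i) U (fun μ => covD (torusT P i) U μ (fun z => (ω z ^ 2) • e z)) x).trace).re
      = ∑ x, ∑ j : Fin N, ∑ k : Fin N, ‖((ω x) • Le x) j k‖ ^ 2 + ∑ x, ((((ω x) • Le x)ᴴ * ((ω x)⁻¹ • R₂ x)).trace).re := by
    rw [← Finset.sum_add_distrib]
    exact Finset.sum_congr rfl fun x _ => by rw [e0, re_trace_split (hω₀ x).ne', re_trace_conjTranspose_mul_self]
  have hE' : ∑ x, ∑ j : Fin N, ∑ k : Fin N, ‖((ω x) • Le x) j k‖ ^ 2 = ∑ x, ω x ^ 2 * ∑ j : Fin N, ∑ k : Fin N, ‖(Le x) j k‖ ^ 2 :=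
    Finset.sum_congr rfl fun x _ => (wt_hs (ω x) (Le x)).symm
  have hcs := abs_sum_re_trace_le_sqrt_mul_sqrt Finset.univ (fun x => (ω x) • Le x) (fun x => (ω x)⁻¹ • R₂ x)
  rw [hE'] at hcs
  rw [e1, hE', Real.sq_sqrt hE2pos]
  have := (abs_le.1 hcs).1
  linarith

/-- ★ **THE TYPE-1 SOURCE PAIRING**: `Σ⟨h, Δ_U(ω²•e)⟩ ≤ H·E + H·R`. [cite: Balaban1984PropagatorsII, (1.9) p.226] -/
theorem el_h_le (ω : Site P i → ℝ) (hω₀ : ∀ x, 0 < ω x) (e h : Site P i → Matrix (Fin N) (Fin N) ℂ) :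
    ∑ x, (((h x)ᴴ * divB (torusT P i) U (fun μ => covD (torusT P i) U μ (fun z => (ω z ^ 2) • e z)) x).trace).re
      ≤ Real.sqrt (∑ x, ω x ^ 2 * ∑ j : Fin N, ∑ k : Fin N, ‖(h x) j k‖ ^ 2)
          * Real.sqrt (∑ x, ω x ^ 2 * ∑ j : Fin N, ∑ k : Fin N, ‖(divB (torusT P i) U (fun μ => covD (torusT P i) U μ e) x) j k‖ ^ 2)
        + Real.sqrt (∑ x, ω x ^ 2 * ∑ j : Fin N, ∑ k : Fin N, ‖(h x) j k‖ ^ 2)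
          * Real.sqrt (∑ x, ∑ j : Fin N, ∑ k : Fin N, ‖((ω x)⁻¹ • (divB (torusT P i) U (fun μ => covD (torusT P i) U μ (fun z => (ω z ^ 2) • e z)) x
              - (ω x ^ 2) • divB (torusT P i) U (fun μ => covD (torusT P i) U μ e) x)) j k‖ ^ 2) := by
  set Le : Site P i → Matrix (Fin N) (Fin N) ℂ := fun x => divB (torusT P i) U (fun μ => covD (torusT P i) U μ e) x with hLe
  set R₂ : Site P i → Matrix (Fin N) (Fin N) ℂ := fun x => divB (torusT P i) U (fun μ => covD (torusT P i) U μ (fun z => (ω z ^ 2) • e z)) x - (ω x ^ 2) • Le x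
    with hR₂
  have e0 : ∀ x, divB (torusT P i) U (fun μ => covD (torusT P i) U μ (fun z => (ω z ^ 2) • e z)) x = (ω x ^ 2) • Le x + R₂ x := fun x => by
    simp only [hR₂]; abel
  have e1 : ∑ x, (((h x)ᴴ * divB (torusT P i) U (fun μ => covD (torusT P i) U μ (fun z => (ω z ^ 2) • e z)) x).trace).re
      = ∑ x, ((((ω x) • h x)ᴴ * ((ω x) • Le x)).trace).re + ∑ x, ((((ω x) • h x)ᴴ * ((ω x)⁻¹ • R₂ x)).trace).re := by
    rw [← Finset.sum_add_distrib]; exact Finset.sum_congr rfl fun x _ => by rw [e0, re_trace_split (hω₀ x).ne']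
  rw [e1]
  have h1 := sum_re_trace_le_sqrt_mul_sqrt Finset.univ (fun x => (ω x) • h x) (fun x => (ω x) • Le x)
  have h2 := sum_re_trace_le_sqrt_mul_sqrt Finset.univ (fun x => (ω x) • h x) (fun x => (ω x)⁻¹ • R₂ x)
  have hH' : ∑ x, ∑ j : Fin N, ∑ k : Fin N, ‖((ω x) • h x) j k‖ ^ 2 = ∑ x, ω x ^ 2 * ∑ j : Fin N, ∑ k : Fin N, ‖(h x) j k‖ ^ 2 :=
    Finset.sum_congr rfl fun x _ => (wt_hs (ω x) (h x)).symm
  have hE' : ∑ x, ∑ j : Fin N, ∑ k : Fin N, ‖((ω x) • Le x) j k‖ ^ 2 = ∑ x, ω x ^ 2 * ∑ j : Fin N, ∑ k : Fin N, ‖(Le x) j k‖ ^ 2 :=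
    Finset.sum_congr rfl fun x _ => (wt_hs (ω x) (Le x)).symm
  rw [hH', hE'] at h1
  rw [hH'] at h2
  exact add_le_add h1 h2

/-- ★ **THE BOND SOURCE PAIRING** (unitary `U`, weight rows): `Σ_{x,μ}⟨ht_μ, D_μ(ω²•e)⟩ ≤ Ht·G + Ht·γN`, `γ = (15∕4)a√d`. [cite: Balaban1984PropagatorsII, (1.9) p.226] -/
theorem el_ht_le (hU : ∀ ν x, (U ν x : Matrix (Fin N) (Fin N) ℂ) ∈ unitary (Matrix (Fin N) (Fin N) ℂ))
    (ω : Site P i → ℝ) (e : Site P i → Matrix (Fin N) (Fin N) ℂ) (ht : Fin P.d → Site P i → Matrix (Fin N) (Fin N) ℂ)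
    {a b : ℝ} (ha0 : 0 ≤ a) (ha : a ≤ 1 / 2) (hω₀ : ∀ x, 0 < ω x)
    (hω₁ : ∀ x μ, |ω (x.shift μ) - ω x| ≤ a * ω x ∧ |ω (x.unshift μ) - ω x| ≤ a * ω x)
    (hω₂ : ∀ x μ, |ω (x.shift μ) + ω (x.unshift μ) - 2 * ω x| ≤ b * ω x) :
    ∑ x, ∑ μ, (((ht μ x)ᴴ * covD (torusT P i) U μ (fun z => (ω z ^ 2) • e z) x).trace).re
      ≤ Real.sqrt (∑ x, ∑ μ, ω x ^ 2 * ∑ j : Fin N, ∑ k : Fin N, ‖(ht μ x) j k‖ ^ 2)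
          * Real.sqrt (∑ x, ∑ μ, ω x ^ 2 * ∑ j : Fin N, ∑ k : Fin N, ‖(covD (torusT P i) U μ e x) j k‖ ^ 2)
        + Real.sqrt (∑ x, ∑ μ, ω x ^ 2 * ∑ j : Fin N, ∑ k : Fin N, ‖(ht μ x) j k‖ ^ 2)
          * ((15 / 4 * a * Real.sqrt P.d) * Real.sqrt (∑ x, ω x ^ 2 * ∑ j : Fin N, ∑ k : Fin N, ‖(e x) j k‖ ^ 2)) := by
  have hLeib : ∀ x μ, covD (torusT P i) U μ (fun z => (ω z ^ 2) • e z) x = (ω x ^ 2) • covD (torusT P i) U μ e x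
      + (ω (torusT P i μ x) ^ 2 - ω x ^ 2) • R (U μ x) (e (torusT P i μ x)) := fun x μ => covD_smul_fun_src U (fun z => ω z ^ 2) e μ x
  have e1 : ∑ x, ∑ μ, (((ht μ x)ᴴ * covD (torusT P i) U μ (fun z => (ω z ^ 2) • e z) x).trace).re
      = ∑ x, ∑ μ, ((((ω x) • ht μ x)ᴴ * ((ω x) • covD (torusT P i) U μ e x)).trace).re
        + ∑ x, ∑ μ, ((((ω x) • ht μ x)ᴴ * (((ω x)⁻¹ * (ω (torusT P i μ x) ^ 2 - ω x ^ 2)) • R (U μ x) (e (torusT P i μ x)))).trace).re := by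
    rw [← Finset.sum_add_distrib]
    refine Finset.sum_congr rfl fun x _ => ?_
    rw [← Finset.sum_add_distrib]
    refine Finset.sum_congr rfl fun μ _ => ?_
    have hx1 : ω x * (ω x)⁻¹ = 1 := mul_inv_cancel₀ (hω₀ x).ne'
    rw [hLeib, mul_add, Matrix.trace_add, Complex.add_re, re_trace_conjTranspose_mul_smul, re_trace_conjTranspose_mul_smul, re_trace_smul_smul,
      re_trace_smul_smul, sq, ← mul_assoc (ω x) (ω x)⁻¹, hx1, one_mul]
  rw [e1]
  have hwt2 : ∀ (F : Fin P.d → Site P i → Matrix (Fin N) (Fin N) ℂ),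
      ∑ p : Site P i × Fin P.d, ∑ j : Fin N, ∑ k : Fin N, ‖((ω p.1) • F p.2 p.1) j k‖ ^ 2 = ∑ x, ∑ μ, ω x ^ 2 * ∑ j : Fin N, ∑ k : Fin N, ‖(F μ x) j k‖ ^ 2 := by
    intro F
    rw [Fintype.sum_prod_type]
    exact Finset.sum_congr rfl fun x _ => Finset.sum_congr rfl fun μ _ => (wt_hs (ω x) (F μ x)).symm
  have h1 := sum_re_trace_le_sqrt_mul_sqrt (Finset.univ : Finset (Site P i × Fin P.d)) (fun p => (ω p.1) • ht p.2 p.1)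
    (fun p => (ω p.1) • covD (torusT P i) U p.2 e p.1)
  rw [hwt2 ht, hwt2 (fun μ x => covD (torusT P i) U μ e x)] at h1
  simp only [Fintype.sum_prod_type] at h1
  have h2 := sum_re_trace_le_sqrt_mul_sqrt (Finset.univ : Finset (Site P i × Fin P.d)) (fun p => (ω p.1) • ht p.2 p.1)
    (fun p => ((ω p.1)⁻¹ * (ω (torusT P i p.2 p.1) ^ 2 - ω p.1 ^ 2)) • R (U p.2 p.1) (e (torusT P i p.2 p.1)))
  rw [hwt2 ht] at h2
  simp only [Fintype.sum_prod_type] at h2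
  have hrem := sum_hs_sqweight_transport_le hU ω e ha0 ha hω₀ hω₁ hω₂
  have hN0 : 0 ≤ ∑ x, ω x ^ 2 * ∑ j : Fin N, ∑ k : Fin N, ‖(e x) j k‖ ^ 2 := Finset.sum_nonneg fun _ _ => by positivity
  have hrem' : Real.sqrt (∑ x, ∑ μ, ∑ j : Fin N, ∑ k : Fin N,
      ‖(((ω x)⁻¹ * (ω (torusT P i μ x) ^ 2 - ω x ^ 2)) • R (U μ x) (e (torusT P i μ x))) j k‖ ^ 2)
      ≤ (15 / 4 * a * Real.sqrt P.d) * Real.sqrt (∑ x, ω x ^ 2 * ∑ j : Fin N, ∑ k : Fin N, ‖(e x) j k‖ ^ 2) := by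
    refine (Real.sqrt_le_sqrt hrem).trans (le_of_eq ?_)
    rw [Real.sqrt_mul' _ hN0, Real.sqrt_sq (by positivity)]
  exact add_le_add h1 (h2.trans (mul_le_mul_of_nonneg_left hrem' (Real.sqrt_nonneg _)))

omit U in
/-- ★ **THE SITE SOURCE PAIRING**: `Σ⟨s, ω²•e⟩ ≤ S·N`. [cite: Balaban1984PropagatorsII, (1.9) p.226] -/
theorem el_s_le (ω : Site P i → ℝ) (e s : Site P i → Matrix (Fin N) (Fin N) ℂ) :
    ∑ x, (((s x)ᴴ * ((ω x ^ 2) • e x)).trace).re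
      ≤ Real.sqrt (∑ x, ω x ^ 2 * ∑ j : Fin N, ∑ k : Fin N, ‖(s x) j k‖ ^ 2) * Real.sqrt (∑ x, ω x ^ 2 * ∑ j : Fin N, ∑ k : Fin N, ‖(e x) j k‖ ^ 2) := by
  have e1 : ∑ x, (((s x)ᴴ * ((ω x ^ 2) • e x)).trace).re = ∑ x, ((((ω x) • s x)ᴴ * ((ω x) • e x)).trace).re :=
    Finset.sum_congr rfl fun x _ => by rw [re_trace_conjTranspose_mul_smul, re_trace_smul_smul, sq]
  rw [e1]
  have h1 := sum_re_trace_le_sqrt_mul_sqrt Finset.univ (fun x => (ω x) • s x) (fun x => (ω x) • e x)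
  have hS' : ∑ x, ∑ j : Fin N, ∑ k : Fin N, ‖((ω x) • s x) j k‖ ^ 2 = ∑ x, ω x ^ 2 * ∑ j : Fin N, ∑ k : Fin N, ‖(s x) j k‖ ^ 2 :=
    Finset.sum_congr rfl fun x _ => (wt_hs (ω x) (s x)).symm
  have hN' : ∑ x, ∑ j : Fin N, ∑ k : Fin N, ‖((ω x) • e x) j k‖ ^ 2 = ∑ x, ω x ^ 2 * ∑ j : Fin N, ∑ k : Fin N, ‖(e x) j k‖ ^ 2 :=
    Finset.sum_congr rfl fun x _ => (wt_hs (ω x) (e x)).symm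
  rw [hS', hN'] at h1
  exact h1

/-- ★ **THE `ω²` COMMUTATOR READ THROUGH `ω⁻¹`**: `√Σhs(ω⁻¹•(Δ_U(ω²•e) − ω²•Δ_Ue)) ≤ √(10d)(5a∕2)·G + √3·d·(2a²+2b)·N`. [cite: Balaban1984PropagatorsII, (1.9) p.226] -/
theorem sqrt_sum_hs_sqcomm_le (hU : ∀ ν x, (U ν x : Matrix (Fin N) (Fin N) ℂ) ∈ unitary (Matrix (Fin N) (Fin N) ℂ))
    (ω : Site P i → ℝ) (e : Site P i → Matrix (Fin N) (Fin N) ℂ) {a b : ℝ} (ha0 : 0 ≤ a) (ha : a ≤ 1 / 2) (hb0 : 0 ≤ b) (hω₀ : ∀ x, 0 < ω x)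
    (hω₁ : ∀ x μ, |ω (x.shift μ) - ω x| ≤ a * ω x ∧ |ω (x.unshift μ) - ω x| ≤ a * ω x)
    (hω₂ : ∀ x μ, |ω (x.shift μ) + ω (x.unshift μ) - 2 * ω x| ≤ b * ω x) :
    Real.sqrt (∑ x, ∑ j : Fin N, ∑ k : Fin N, ‖((ω x)⁻¹ • (divB (torusT P i) U (fun μ => covD (torusT P i) U μ (fun z => (ω z ^ 2) • e z)) x
        - (ω x ^ 2) • divB (torusT P i) U (fun μ => covD (torusT P i) U μ e) x)) j k‖ ^ 2)
      ≤ Real.sqrt (10 * P.d) * (5 / 2 * a) * Real.sqrt (∑ x, ∑ μ, ω x ^ 2 * ∑ j : Fin N, ∑ k : Fin N, ‖(covD (torusT P i) U μ e x) j k‖ ^ 2)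
        + Real.sqrt 3 * P.d * (2 * a ^ 2 + 2 * b) * Real.sqrt (∑ x, ω x ^ 2 * ∑ j : Fin N, ∑ k : Fin N, ‖(e x) j k‖ ^ 2) := by
  have rows := fun x μ => sq_weight_rows ω ha0 ha hω₀ hω₁ hω₂ x μ
  have h1 := sum_hs_weighted_comm_le hU ω (fun y => ω y ^ 2) (fun y => (ω y)⁻¹) e ha hω₀ hω₁
    (fun x => (inv_pos.mpr (hω₀ x)).le) (fun x μ => (rows x μ).1) (fun x μ => (rows x μ).2)
  have e0 : ∑ x, ∑ j : Fin N, ∑ k : Fin N, ‖((ω x)⁻¹ • (divB (torusT P i) U (fun μ => covD (torusT P i) U μ (fun z => (ω z ^ 2) • e z)) x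
        - (ω x ^ 2) • divB (torusT P i) U (fun μ => covD (torusT P i) U μ e) x)) j k‖ ^ 2
      = ∑ x, (ω x)⁻¹ ^ 2 * ∑ j : Fin N, ∑ k : Fin N,
        ‖(divB (torusT P i) U (fun μ => covD (torusT P i) U μ (fun z => (ω z ^ 2) • e z)) x - (ω x ^ 2) • divB (torusT P i) U (fun μ => covD (torusT P i) U μ e) x) j k‖ ^ 2 :=
    Finset.sum_congr rfl fun x _ => by rw [hs_smul]
  rw [e0]
  refine (Real.sqrt_le_sqrt h1).trans ?_
  have hG0 : 0 ≤ ∑ x, ∑ μ, ω x ^ 2 * ∑ j : Fin N, ∑ k : Fin N, ‖(covD (torusT P i) U μ e x) j k‖ ^ 2 :=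
    Finset.sum_nonneg fun _ _ => Finset.sum_nonneg fun _ _ => by positivity
  have hN0 : 0 ≤ ∑ x, ω x ^ 2 * ∑ j : Fin N, ∑ k : Fin N, ‖(e x) j k‖ ^ 2 := Finset.sum_nonneg fun _ _ => by positivity
  have h3 := sqrt_comm_bound_le (d := P.d) (c := (1 : ℝ)) (α := 5 / 2 * a) (β := 2 * a ^ 2 + 2 * b) (by positivity) (by positivity) hG0 hN0
  simp only [one_pow, mul_one, abs_one] at h3
  exact h3

/-- ★ **THE `θ = 1` COMMUTATOR**: `√Σhs(Δ_U(ω•e) − ω•Δ_Ue) ≤ √(10d)·a·G + √3·d·b·N`. [cite: Balaban1984PropagatorsII, (1.9) p.226] -/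
theorem sqrt_sum_hs_comm_le (hU : ∀ ν x, (U ν x : Matrix (Fin N) (Fin N) ℂ) ∈ unitary (Matrix (Fin N) (Fin N) ℂ))
    (ω : Site P i → ℝ) (e : Site P i → Matrix (Fin N) (Fin N) ℂ) {a b : ℝ} (ha0 : 0 ≤ a) (ha : a ≤ 1 / 2) (hb0 : 0 ≤ b) (hω₀ : ∀ x, 0 < ω x)
    (hω₁ : ∀ x μ, |ω (x.shift μ) - ω x| ≤ a * ω x ∧ |ω (x.unshift μ) - ω x| ≤ a * ω x)
    (hω₂ : ∀ x μ, |ω (x.shift μ) + ω (x.unshift μ) - 2 * ω x| ≤ b * ω x) :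
    Real.sqrt (∑ x, ∑ j : Fin N, ∑ k : Fin N, ‖(divB (torusT P i) U (fun μ => covD (torusT P i) U μ (fun z => (ω z) • e z)) x
        - (ω x) • divB (torusT P i) U (fun μ => covD (torusT P i) U μ e) x) j k‖ ^ 2)
      ≤ Real.sqrt (10 * P.d) * a * Real.sqrt (∑ x, ∑ μ, ω x ^ 2 * ∑ j : Fin N, ∑ k : Fin N, ‖(covD (torusT P i) U μ e x) j k‖ ^ 2)
        + Real.sqrt 3 * P.d * b * Real.sqrt (∑ x, ω x ^ 2 * ∑ j : Fin N, ∑ k : Fin N, ‖(e x) j k‖ ^ 2) := by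
  have h1 := sum_hs_weighted_comm_le hU ω ω (fun _ => (1 : ℝ)) e ha hω₀ hω₁ (fun _ => zero_le_one)
    (fun x μ => by simpa only [one_mul] using hω₁ x μ) (fun x μ => by simpa only [one_mul] using hω₂ x μ)
  simp only [one_pow, one_mul] at h1
  refine (Real.sqrt_le_sqrt h1).trans ?_
  have hG0 : 0 ≤ ∑ x, ∑ μ, ω x ^ 2 * ∑ j : Fin N, ∑ k : Fin N, ‖(covD (torusT P i) U μ e x) j k‖ ^ 2 :=
    Finset.sum_nonneg fun _ _ => Finset.sum_nonneg fun _ _ => by positivity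
  have hN0 : 0 ≤ ∑ x, ω x ^ 2 * ∑ j : Fin N, ∑ k : Fin N, ‖(e x) j k‖ ^ 2 := Finset.sum_nonneg fun _ _ => by positivity
  have h3 := sqrt_comm_bound_le (d := P.d) (c := (1 : ℝ)) (α := a) (β := b) ha0 hb0 hG0 hN0
  simp only [one_pow, mul_one, abs_one] at h3
  exact h3

end Pieces


end Summit.QuantumFields.YangMills.Theorems.Prop7CovAgmonPieces

end
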